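import Literature.Computability.QuantumComplexity.RevArith
import HarnessLib

/-!
# Reversible arithmetic gadgets, II: straight-line register programs compiled to `NOT`/`CNOT`/Toffoli

Topic `Literature/Computability/QuantumComplexity`; infrastructure for the discharge of
`ajl_jonesApproxProblem_mem_PromiseBQP` (`JonesInBQP.lean`), sequel of `RevArith.lean`. The integer
predicates that cut the dyadic intervals of the block encodings (`HadamardSandwich.lean`) at
golden-ratio points are Boolean combinations of comparisons between integer polynomials of degree
`≤ 4` in the value of a register. This file provides a small **verified compiler** for such
computations: *straight-line programs* over `ℕ`-valued registers of a fixed width `Wd` and Boolean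
flags — instructions `copyIn d off len` (load a field of the external input), `setBit` (a power of two), `add d a b sh`
(`d := a + b·2^{sh} mod 2^{Wd}`), `andBit d x i y` (`d := [bit i of x] · y`, the rows of schoolbook
multiplication), `lt f a b` (`f := [a < b]`), `fnot`, `fand`, `forr` — compiled, instruction by
instruction and always into *fresh* wires, to `ClOp ℕ` programs (the proof-free `NOT`/`CNOT`/Toffoli
layer of `RevGadgets.lean`, wires numbered by an explicit affine **layout**), together with the
interpreter `SLP.run`, the wire layouts and the simulation invariant `SLP.Inv`; the step lemmas and
the **compiler correctness theorem** `SLP.clEval_compile` are in the sequel `RevSLPSteps.lean`, the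
multiplication macro in `RevSLPMul.lean`. (Garbage — carries, comparator scratch — stays on the scratch
wires; it is meant to be uncomputed by running the program backwards after the computed flag has been
used, Bennett 1973 / Nielsen–Chuang 2010, §3.2.5.)

Wires being natural numbers given by affine formulas in the register/flag/instruction indices, the
compiled programs are printable by the generator programs of `RevTableauUniform.lean` (uniformity is
not treated here).

## Contents

* syntax `SLP.Instr`, states `SLP.State`, interpreter `SLP.step`/`SLP.run` (`run_append`, `run_regs_lt`);
* layouts `SLP.Layout` (`regW`, `flagW`, scratch blocks `carW`/`zerW`/`sumW` inside `scrW`, external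
  input `iw`), the adder/comparator embeddings `addEmb`/`ltEmb`, compilation `SLP.compileInstr`,
  `SLP.compileFrom`, `SLP.compile`;
* layout arithmetic (`regW_inj`, `scrW_inj`, the disjointness lemmas under `SLP.Layout.Valid`);
* the simulation invariant `SLP.Inv` (`inv_init`, `Inv.mono`, `Inv.regVal_eq`).

## References

* V. Vedral, A. Barenco, A. Ekert, *Quantum networks for elementary arithmetic operations*,
  Phys. Rev. A 54 (1996), §3.1 (plain adder), §3.3 (multiplication by repeated shifted addition)
  [VedralBarencoEkert1996].
* M. A. Nielsen, I. L. Chuang, *Quantum Computation and Quantum Information*, CUP 2010, §3.2.5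
  [NielsenChuang2010].
* S. Arora, B. Barak, *Computational Complexity: A Modern Approach*, CUP 2009, §10.3.7 Lemma 10.10
  [AroraBarakCC2009].
-/

namespace Literature.Computability.QuantumComplexity

open Function

/-! ### Straight-line register programs -/

namespace SLP

/-- Instructions of straight-line register programs (registers and flags named by naturals; every
instruction writes a fresh register or flag). [folklore] -/
inductive Instr
  /-- `d :=` bits `off, …, off + len − 1` of the external input -/
  | copyIn (d off len : ℕ)
  /-- `d := 2^i` -/
  | setBit (d i : ℕ)
  /-- `d := a + b·2^sh (mod 2^Wd)` -/
  | add (d a b sh : ℕ)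
  /-- `d := [bit i of x] · y` -/
  | andBit (d x i y : ℕ)
  /-- `f := [a < b]` -/
  | lt (f a b : ℕ)
  /-- `f := ¬ g` -/
  | fnot (f g : ℕ)
  /-- `f := g ∧ h` -/
  | fand (f g h : ℕ)
  /-- `f := g ∨ h` -/
  | forr (f g h : ℕ)
  deriving DecidableEq

/-- States of the interpreter: register values and flags. [folklore] -/
structure State where
  /-- register values -/
  regs : ℕ → ℕ
  /-- flags -/
  flags : ℕ → Bool

/-- The initial state: everything zero. [folklore] -/
def State.init : State := ⟨fun _ => 0, fun _ => false⟩

variable (Wd : ℕ) (inp : ℕ)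

/-- **One instruction of the interpreter** (register width `Wd`, external input `inp`). [folklore] -/
def step (st : State) : Instr → State
  | .copyIn d off len => { st with regs := update st.regs d ((inp / 2 ^ off % 2 ^ len) % 2 ^ Wd) }
  | .setBit d i => { st with regs := update st.regs d (if i < Wd then 2 ^ i else 0) }
  | .add d a b sh => { st with regs := update st.regs d ((st.regs a + st.regs b * 2 ^ sh) % 2 ^ Wd) }
  | .andBit d x i y => { st with regs := update st.regs d (if (st.regs x).testBit i then st.regs y else 0) }
  | .lt f a b => { st with flags := update st.flags f (decide (st.regs a < st.regs b)) }
  | .fnot f g => { st with flags := update st.flags f (!st.flags g) }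
  | .fand f g h => { st with flags := update st.flags f (st.flags g && st.flags h) }
  | .forr f g h => { st with flags := update st.flags f (st.flags g || st.flags h) }

/-- **Running a program** (head first). [folklore] -/
def run (st : State) : List Instr → State
  | [] => st
  | ins :: p => run (step Wd inp st ins) p

/-- Running a concatenation. [folklore] -/
theorem run_append (st : State) (p q : List Instr) : run Wd inp st (p ++ q) = run Wd inp (run Wd inp st p) q := by
  induction p generalizing st with
  | nil => rfl
  | cons i p ih => exact ih _

/-- All register values of a run from a bounded state stay below `2^Wd`. [folklore] -/
theorem run_regs_lt {st : State} (hst : ∀ ρ, st.regs ρ < 2 ^ Wd) (p : List Instr) (ρ : ℕ) : (run Wd inp st p).regs ρ < 2 ^ Wd := by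
  induction p generalizing st with
  | nil => exact hst ρ
  | cons ins p ih =>
    apply ih
    intro ρ'
    have h2 : 0 < 2 ^ Wd := Nat.two_pow_pos Wd
    cases ins with
    | copyIn d off len => simp only [step]; rw [update_apply]; split_ifs; exacts [Nat.mod_lt _ h2, hst ρ']
    | setBit d i =>
      simp only [step]; rw [update_apply]; split_ifs with h1 h3
      · exact Nat.pow_lt_pow_right (by norm_num) h3
      · exact h2
      · exact hst ρ'
    | add d a b sh => simp only [step]; rw [update_apply]; split_ifs; exacts [Nat.mod_lt _ h2, hst ρ']
    | andBit d x i y => simp only [step]; rw [update_apply]; split_ifs; exacts [hst y, h2, hst ρ']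
    | lt f a b => exact hst ρ'
    | fnot f g => exact hst ρ'
    | fand f g h => exact hst ρ'
    | forr f g h => exact hst ρ'

/-- One step from a bounded state is bounded. [folklore] -/
theorem step_regs_lt {st : State} (hst : ∀ ρ, st.regs ρ < 2 ^ Wd) (ins : Instr) (ρ : ℕ) : (step Wd inp st ins).regs ρ < 2 ^ Wd :=
  run_regs_lt Wd inp hst [ins] ρ

/-! ### Layouts and compilation -/

/-- **A wire layout** for programs of width `Wd`: the register block (register `ρ`, bit `j` on wire
`rb + ρ·Wd + j`), the flag block (`fb + φ`), per-instruction scratch blocks of size `3Wd + 1`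
(carries, constant zeros, comparator sums of instruction number `t` from `sb + t(3Wd+1)`), and the
external input wires `iw j`, `j < kIn`, carrying the `kIn`-bit input. [folklore] -/
structure Layout where
  /-- the number of input bits read by `copyIn` -/
  kIn : ℕ
  /-- base of the register block -/
  rb : ℕ
  /-- base of the flag block -/
  fb : ℕ
  /-- base of the scratch blocks -/
  sb : ℕ
  /-- the external input wires -/
  iw : ℕ → ℕ

variable {Wd}
variable (L : Layout)

/-- Wire of bit `j` of register `ρ`. [folklore] -/
def Layout.regW (ρ j : ℕ) : ℕ := L.rb + ρ * Wd + j

/-- Wire of flag `φ`. [folklore] -/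
def Layout.flagW (φ : ℕ) : ℕ := L.fb + φ

/-- Size of a scratch block. [folklore] -/
def scrSize (Wd : ℕ) : ℕ := 3 * Wd + 1

/-- Carry wire `j ≤ Wd` of instruction `t`. [folklore] -/
def Layout.carW (t j : ℕ) : ℕ := L.sb + t * scrSize Wd + j

/-- Constant-zero wire `j < Wd` of instruction `t`. [folklore] -/
def Layout.zerW (t j : ℕ) : ℕ := L.sb + t * scrSize Wd + (Wd + 1) + j

/-- Comparator sum wire `j < Wd` of instruction `t`. [folklore] -/
def Layout.sumW (t j : ℕ) : ℕ := L.sb + t * scrSize Wd + (2 * Wd + 1) + j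

/-- The embedding of the adder wires for `add d a b sh` as instruction number `t`: `a ↦` register `a`,
`b ↦` register `b` shifted by `sh` (constant zeros below the shift), `s ↦` register `d`,
`c ↦` the carries of block `t`. [cite: VedralBarencoEkert1996, §3.1] -/
def Layout.addEmb (t d a b sh : ℕ) : AddW Wd → ℕ
  | AddW.a j => L.regW (Wd := Wd) a j
  | AddW.b j => if sh ≤ (j : ℕ) then L.regW (Wd := Wd) b (j - sh) else L.zerW (Wd := Wd) t j
  | AddW.s j => L.regW (Wd := Wd) d j
  | AddW.c j => L.carW (Wd := Wd) t j

/-- The embedding of the comparator wires for `lt f a b` as instruction number `t`: the comparator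
computes `[value(b-wires) < value(a-wires)]`, so `a ↦` register `b`, `b ↦` register `a`. [folklore] -/
def Layout.ltEmb (t a b : ℕ) : AddW Wd → ℕ
  | AddW.a j => L.regW (Wd := Wd) b j
  | AddW.b j => L.regW (Wd := Wd) a j
  | AddW.s j => L.sumW (Wd := Wd) t j
  | AddW.c j => L.carW (Wd := Wd) t j

/-- **Compilation of one instruction** (as instruction number `t`). [cite: VedralBarencoEkert1996, §3.1 and §3.3] -/
def compileInstr (t : ℕ) : Instr → List (ClOp ℕ)
  | .copyIn d off len => (List.range len).map fun j => ClOp.cnot (L.iw (off + j)) (L.regW (Wd := Wd) d j)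
  | .setBit d i => if i < Wd then [ClOp.not (L.regW (Wd := Wd) d i)] else []
  | .add d a b sh => (addOps Wd).map (ClOp.map (L.addEmb (Wd := Wd) t d a b sh))
  | .andBit d x i y => (List.range Wd).map fun j => ClOp.toffoli (L.regW (Wd := Wd) x i) (L.regW (Wd := Wd) y j) (L.regW (Wd := Wd) d j)
  | .lt f a b => (ltOps Wd).map (ClOp.map (L.ltEmb (Wd := Wd) t a b)) ++ [ClOp.cnot (L.carW (Wd := Wd) t Wd) (L.flagW f)]
  | .fnot f g => [ClOp.cnot (L.flagW g) (L.flagW f), ClOp.not (L.flagW f)]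
  | .fand f g h => [ClOp.toffoli (L.flagW g) (L.flagW h) (L.flagW f)]
  | .forr f g h => [ClOp.not (L.flagW g), ClOp.not (L.flagW h), ClOp.toffoli (L.flagW g) (L.flagW h) (L.flagW f),
      ClOp.not (L.flagW f), ClOp.not (L.flagW g), ClOp.not (L.flagW h)]

/-- **Compilation of a program** whose first instruction gets number `t`. [folklore] -/
def compileFrom : ℕ → List Instr → List (ClOp ℕ)
  | _, [] => []
  | t, ins :: p => compileInstr L (Wd := Wd) t ins ++ compileFrom (t + 1) p

/-- Compilation of a program. [folklore] -/
def compile (p : List Instr) : List (ClOp ℕ) := compileFrom L (Wd := Wd) 0 p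


/-! ### Layout arithmetic -/

section LayoutLemmas

variable {Wd : ℕ} (L : Layout)

/-- Scratch wire `o` of block `t` (carries `o ≤ Wd`, zeros `Wd+1 ≤ o ≤ 2Wd`, sums `2Wd+1 ≤ o ≤ 3Wd`).
[folklore] -/
def Layout.scrW (t o : ℕ) : ℕ := L.sb + t * scrSize Wd + o

/-- Carries are scratch wires. [folklore] -/
theorem Layout.carW_eq (t j : ℕ) : L.carW (Wd := Wd) t j = L.scrW (Wd := Wd) t j := rfl

/-- Zeros are scratch wires. [folklore] -/
theorem Layout.zerW_eq (t j : ℕ) : L.zerW (Wd := Wd) t j = L.scrW (Wd := Wd) t (Wd + 1 + j) := by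
  simp [Layout.zerW, Layout.scrW, Nat.add_assoc]

/-- Sums are scratch wires. [folklore] -/
theorem Layout.sumW_eq (t j : ℕ) : L.sumW (Wd := Wd) t j = L.scrW (Wd := Wd) t (2 * Wd + 1 + j) := by
  simp [Layout.sumW, Layout.scrW, Nat.add_assoc]

/-- **Validity of a layout** for programs of width `Wd ≥ kIn` with register indices `< R` and flag
indices `< F`: input wires injective and below the register block, register block below the flag
block below the scratch blocks. [folklore] -/
structure Layout.Valid (L : Layout) (Wd R F : ℕ) : Prop where
  /-- the input is at most as wide as the registers -/
  kIn_le : L.kIn ≤ Wd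
  /-- input wires are below the register block -/
  iw_lt : ∀ j, j < L.kIn → L.iw j < L.rb
  /-- input wires are distinct -/
  iw_inj : ∀ j j', j < L.kIn → j' < L.kIn → L.iw j = L.iw j' → j = j'
  /-- the flag block starts after the register block -/
  fb_ge : L.rb + R * Wd ≤ L.fb
  /-- the scratch blocks start after the flag block -/
  sb_ge : L.fb + F ≤ L.sb

variable {L} {R F : ℕ}

/-- Register wires lie in the register block. [folklore] -/
theorem Layout.regW_bounds {ρ j : ℕ} (hρ : ρ < R) (hj : j < Wd) :
    L.rb ≤ L.regW (Wd := Wd) ρ j ∧ L.regW (Wd := Wd) ρ j < L.rb + R * Wd := by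
  refine ⟨by simp [Layout.regW, Nat.add_assoc], ?_⟩
  have : ρ * Wd + j < R * Wd := by
    calc ρ * Wd + j < ρ * Wd + Wd := by omega
      _ = (ρ + 1) * Wd := by ring
      _ ≤ R * Wd := Nat.mul_le_mul_right _ hρ
  simp only [Layout.regW]; omega

/-- Register wires determine register and bit. [folklore] -/
theorem Layout.regW_inj {ρ ρ' j j' : ℕ} (hj : j < Wd) (hj' : j' < Wd) (h : L.regW (Wd := Wd) ρ j = L.regW (Wd := Wd) ρ' j') :
    ρ = ρ' ∧ j = j' := by
  simp only [Layout.regW] at h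
  have h1 : j + ρ * Wd = j' + ρ' * Wd := by omega
  have hW : 0 < Wd := by omega
  have e1 : (j + ρ * Wd) / Wd = (j' + ρ' * Wd) / Wd := by rw [h1]
  rw [Nat.add_mul_div_right _ _ hW, Nat.add_mul_div_right _ _ hW, Nat.div_eq_of_lt hj, Nat.div_eq_of_lt hj'] at e1
  have e2 : (j + ρ * Wd) % Wd = (j' + ρ' * Wd) % Wd := by rw [h1]
  rw [Nat.add_mul_mod_self_right, Nat.add_mul_mod_self_right, Nat.mod_eq_of_lt hj, Nat.mod_eq_of_lt hj'] at e2
  exact ⟨by simpa using e1, e2⟩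

/-- Scratch wires lie in their block. [folklore] -/
theorem Layout.scrW_bounds {t o : ℕ} (ho : o < scrSize Wd) :
    L.sb + t * scrSize Wd ≤ L.scrW (Wd := Wd) t o ∧ L.scrW (Wd := Wd) t o < L.sb + (t + 1) * scrSize Wd := by
  simp only [Layout.scrW]; constructor <;> nlinarith

/-- Scratch wires determine block and offset. [folklore] -/
theorem Layout.scrW_inj {t t' o o' : ℕ} (ho : o < scrSize Wd) (ho' : o' < scrSize Wd)
    (h : L.scrW (Wd := Wd) t o = L.scrW (Wd := Wd) t' o') : t = t' ∧ o = o' := by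
  simp only [Layout.scrW] at h
  have h1 : o + t * scrSize Wd = o' + t' * scrSize Wd := by omega
  have hS : 0 < scrSize Wd := by unfold scrSize; omega
  have e1 : (o + t * scrSize Wd) / scrSize Wd = (o' + t' * scrSize Wd) / scrSize Wd := by rw [h1]
  rw [Nat.add_mul_div_right _ _ hS, Nat.add_mul_div_right _ _ hS, Nat.div_eq_of_lt ho, Nat.div_eq_of_lt ho'] at e1
  have e2 : (o + t * scrSize Wd) % scrSize Wd = (o' + t' * scrSize Wd) % scrSize Wd := by rw [h1]
  rw [Nat.add_mul_mod_self_right, Nat.add_mul_mod_self_right, Nat.mod_eq_of_lt ho, Nat.mod_eq_of_lt ho'] at e2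
  exact ⟨by simpa using e1, e2⟩

/-- Flag wires are distinct for distinct flags. [folklore] -/
theorem flagW_injective : Function.Injective L.flagW := fun a b h => by simpa [Layout.flagW] using h

variable (hV : L.Valid Wd R F)
include hV

/-- A register wire is not a flag wire. [folklore] -/
theorem Layout.regW_ne_flagW {ρ j φ : ℕ} (hρ : ρ < R) (hj : j < Wd) : L.regW (Wd := Wd) ρ j ≠ L.flagW φ := by
  have := (Layout.regW_bounds (L := L) hρ hj).2; have := hV.fb_ge; simp only [Layout.flagW]; omega

/-- A register wire is not a scratch wire. [folklore] -/
theorem Layout.regW_ne_scrW {ρ j t o : ℕ} (hρ : ρ < R) (hj : j < Wd) : L.regW (Wd := Wd) ρ j ≠ L.scrW (Wd := Wd) t o := by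
  have := (Layout.regW_bounds (L := L) hρ hj).2; have := hV.fb_ge; have := hV.sb_ge; simp only [Layout.scrW]; omega

/-- A flag wire is not a scratch wire. [folklore] -/
theorem Layout.flagW_ne_scrW {φ t o : ℕ} (hφ : φ < F) : L.flagW φ ≠ L.scrW (Wd := Wd) t o := by
  have := hV.sb_ge; simp only [Layout.scrW, Layout.flagW]; omega

/-- An input wire is not a register wire. [folklore] -/
theorem Layout.iw_ne_regW {i ρ j : ℕ} (hi : i < L.kIn) : L.iw i ≠ L.regW (Wd := Wd) ρ j := by
  have := hV.iw_lt i hi; simp only [Layout.regW]; omega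

/-- An input wire is not a flag wire. [folklore] -/
theorem Layout.iw_ne_flagW {i φ : ℕ} (hi : i < L.kIn) : L.iw i ≠ L.flagW φ := by
  have := hV.iw_lt i hi; have := hV.fb_ge; simp only [Layout.flagW]; omega

/-- An input wire is not a scratch wire. [folklore] -/
theorem Layout.iw_ne_scrW {i t o : ℕ} (hi : i < L.kIn) : L.iw i ≠ L.scrW (Wd := Wd) t o := by
  have := hV.iw_lt i hi; have := hV.fb_ge; have := hV.sb_ge; simp only [Layout.scrW]; omega

end LayoutLemmas

/-! ### The invariant -/

section Invariant

variable {Wd : ℕ} (L : Layout) (inp R F T : ℕ)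

/-- **The simulation invariant before instruction number `t`**: register wires spell the register
values, flag wires the flags, the scratch blocks from `t` on are clear, the input wires hold the
input, and all register values are `Wd`-bit. [folklore] -/
structure Inv (t : ℕ) (st : State) (w : ℕ → Bool) : Prop where
  /-- register wires spell the register values -/
  regs : ∀ ρ, ρ < R → ∀ j, j < Wd → w (L.regW (Wd := Wd) ρ j) = (st.regs ρ).testBit j
  /-- flag wires hold the flags -/
  flags : ∀ φ, φ < F → w (L.flagW φ) = st.flags φ
  /-- the scratch blocks not yet used are clear -/
  scr : ∀ t', t ≤ t' → t' < T → ∀ o, o < scrSize Wd → w (L.scrW (Wd := Wd) t' o) = false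
  /-- the input wires hold the input -/
  input : ∀ j, j < L.kIn → w (L.iw j) = inp.testBit j
  /-- register values are `Wd`-bit -/
  bound : ∀ ρ, st.regs ρ < 2 ^ Wd

variable {L inp R F T}

/-- The invariant holds initially on an assignment carrying the input and clear on the layout.
[folklore] -/
theorem inv_init {w : ℕ → Bool} (hregs : ∀ ρ, ρ < R → ∀ j, j < Wd → w (L.regW (Wd := Wd) ρ j) = false)
    (hflags : ∀ φ, φ < F → w (L.flagW φ) = false) (hscr : ∀ t', t' < T → ∀ o, o < scrSize Wd → w (L.scrW (Wd := Wd) t' o) = false)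
    (hinput : ∀ j, j < L.kIn → w (L.iw j) = inp.testBit j) :
    Inv L inp R F T (Wd := Wd) 0 State.init w :=
  ⟨fun ρ hρ j hj => by rw [hregs ρ hρ j hj]; simp [State.init], fun φ hφ => by rw [hflags φ hφ]; rfl,
    fun t' _ ht' o ho => hscr t' ht' o ho, hinput, fun _ => Nat.two_pow_pos Wd⟩

/-- Weakening the invariant to a later instruction number does not need anything (fewer blocks are
claimed clear). [folklore] -/
theorem Inv.mono {t t₁ : ℕ} (h : t ≤ t₁) {st : State} {w : ℕ → Bool} (hI : Inv L inp R F T (Wd := Wd) t st w) :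
    Inv L inp R F T (Wd := Wd) t₁ st w :=
  ⟨hI.regs, hI.flags, fun t' ht' => hI.scr t' (h.trans ht'), hI.input, hI.bound⟩

/-- The value of a register, read off an assignment satisfying the invariant. [folklore] -/
theorem Inv.regVal_eq {t : ℕ} {st : State} {w : ℕ → Bool} (hI : Inv L inp R F T (Wd := Wd) t st w) {ρ : ℕ} (hρ : ρ < R) :
    regVal (fun j : Fin Wd => L.regW (Wd := Wd) ρ j) w = st.regs ρ :=
  regVal_eq_of_testBit _ _ (hI.bound ρ) fun j => hI.regs ρ hρ j j.2

end Invariant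

end SLP

end Literature.Computability.QuantumComplexity
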